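import Summits.HodgeConjecture.HodgeConjecture.Theorems.F0P3bArchDegOnePackageDefs
import HarnessLib

/-!
# FLOOR-0 P3b «ENGINE local packets T3 ∕ T4», line `F0_LocalAPackets` — STUB T3a₄ CLOSED:
# `IsUnitaryAlongP` from an invariant positive-definite Hermitian form (generic `U(α, β)`)

Cell hodgecm-mathlib (D-0151), FLOOR 0, crux item H413 = stmt-HodgeConjecture-24833; sub-line
`Cruxes/H413/Lines/F0_LocalAPackets.lean` (F0P3b-plan (g4), edition 1, commit 2a4b8a813d3e), registered stub
`stub_T3aUnitaryAlongPOfHermitian : StubT3aUnitaryAlongPOfHermitian` (§2 there; card brief B4).  PROOF lane (theorems only: seven generic `Re H` lemmas and the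
head; no `def`, no `sorry`); author A-p18 (g17).  Per the cell's stub-closer protocol (director s347) the Lines module is NOT imported: the
theorem's TYPE is the body of `…Cruxes.H413.F0LocalAPackets.StubT3aUnitaryAlongPOfHermitian` BINDER FOR BINDER, with the line-local
predicate `HasInvariantHermitianForm ρ𝔤` replaced by ITS body verbatim (an `∃ H, …` hypothesis), so that the by-name fold
`theorem stub_T3aUnitaryAlongPOfHermitian : StubT3aUnitaryAlongPOfHermitian :=
  F0P3bStubT3aUnitaryAlongPOfHermitian.stubT3aUnitaryAlongPOfHermitian_holds`
elaborates by unfolding the two `def`s at the line's next edition.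

Content ([BorelWallach2000, II §2.1, §3.1]; the line card's «`B := Re H`»).  Given a form `H : V →ₗ⋆[ℂ] V →ₗ[ℂ] ℂ`, conjugate-linear
in the first variable, Hermitian (`H v w = conj (H w v)`), positive definite (`0 < Re H(v, v)` for `v ≠ 0`) and for which every
`ρ𝔤(X)`, `X ∈ 𝔲(α, β)`, is skew, the REAL bilinear form `B(a, b) := Re H(a, b)` on the `𝔤`-module carrier `GKCarrier (uFormGroup α β) ρ𝔤`
(= `V`, bracket `⁅X, v⁆ = ρ𝔤 X v`) is symmetric, positive definite, skew for the `𝔭`-frame `upqPBasis s` and for `z₀ = upqZ0 α β`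
(indeed for all of `𝔤`), and satisfies `B(i a, b) = Re(−i H(a,b)) = Im H(a,b) = −B(a, i b)` — i.e. `IsUnitaryAlongP ρ𝔤`
(★ `Theorems/F0P3bArchDegOnePackageDefs`, def body of the T6 package's unitarity predicate).

HC_CM is proved only modulo the 7 printed citations until rung 0 closes; this closes ONE generic stub (T3a₄) of ONE floor-0 sub-line.

## References
* [BorelWallach2000] A. Borel, N. Wallach, *Continuous Cohomology, Discrete Subgroups, and Representations of Reductive Groups*,
  2nd ed., AMS 2000 — II §2.1 (unitary `(𝔤, K)`-modules: `π(X)` skew-Hermitian), II §3.1.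
-/

-- Mathlib idiom (as in `GKModules`, the `Upq*` files and the line): commutator bracket on `Module.End`
attribute [local instance 100] LieRing.ofAssociativeRing

set_option autoImplicit false
set_option linter.dupNamespace false

noncomputable section

namespace Summit.HodgeConjecture.HodgeConjecture.Cruxes.H413.F0P3bStubT3aUnitaryAlongPOfHermitian

open Literature.NumberTheory.Automorphic
open Literature.RepresentationTheory.BorelWallach2000
open Literature.RepresentationTheory.KonnoKonno2007 Literature.RepresentationTheory.KonnoKonno2007.RealDualPair
open Literature.RepresentationTheory.KonnoKonno2007.RealDualPair.UForm
open Summit.HodgeConjecture.HodgeConjecture.Cruxes.H413.F0P3bArchDegOnePackage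

/-! ## §1 Generic: the real part of a Hermitian form (theorems only, no definition) -/

section Generic

variable {V : Type*} [AddCommGroup V] [Module ℂ V]

/-- **Conjugate-linearity in the first variable is real-linearity of the real part**: `Re H(t•a, b) = t · Re H(a, b)` for
`t ∈ ℝ` (`conj t = t`). [folklore] -/
theorem re_apply_real_smul_left (H : V →ₗ⋆[ℂ] V →ₗ[ℂ] ℂ) (t : ℝ) (a b : V) :
    (H (t • a) b).re = t * (H a b).re := by
  rw [← Complex.coe_smul, LinearMap.map_smulₛₗ, LinearMap.smul_apply, starRingEnd_apply, Complex.star_def,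
    Complex.conj_ofReal, smul_eq_mul, Complex.re_ofReal_mul]

/-- `Re H(a, t•b) = t · Re H(a, b)` for `t ∈ ℝ`. [folklore] -/
theorem re_apply_real_smul_right (H : V →ₗ⋆[ℂ] V →ₗ[ℂ] ℂ) (t : ℝ) (a b : V) :
    (H a (t • b)).re = t * (H a b).re := by
  rw [← Complex.coe_smul, map_smul, smul_eq_mul, Complex.re_ofReal_mul]

/-- **Symmetry**: a Hermitian form has symmetric real part, `Re H(a,b) = Re conj H(b,a) = Re H(b,a)`. [folklore] -/
theorem re_apply_comm (H : V →ₗ⋆[ℂ] V →ₗ[ℂ] ℂ) (hH : ∀ v w, H v w = starRingEnd ℂ (H w v)) (a b : V) :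
    (H a b).re = (H b a).re := by
  rw [hH a b, Complex.conj_re]

/-- **Non-negativity** of `Re H(a, a)` for a positive-definite form (`a = 0` gives `0`). [folklore] -/
theorem re_apply_self_nonneg (H : V →ₗ⋆[ℂ] V →ₗ[ℂ] ℂ) (hpos : ∀ v, v ≠ 0 → 0 < (H v v).re) (a : V) :
    0 ≤ (H a a).re := by
  by_cases ha : a = 0
  · subst ha
    simp only [map_zero, Complex.zero_re, le_refl]
  · exact (hpos a ha).le

/-- **Definiteness**: `Re H(a, a) = 0 ⇒ a = 0` for a positive-definite form. [folklore] -/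
theorem eq_zero_of_re_apply_self_eq_zero (H : V →ₗ⋆[ℂ] V →ₗ[ℂ] ℂ) (hpos : ∀ v, v ≠ 0 → 0 < (H v v).re) (a : V)
    (h : (H a a).re = 0) : a = 0 := by
  by_contra ha
  have h' := hpos a ha
  rw [h] at h'
  exact lt_irrefl 0 h'

/-- **Skewness transports to the real part**: if `T` is `H`-skew then `Re H(T a, b) = −Re H(a, T b)`. [folklore] -/
theorem re_apply_skew (H : V →ₗ⋆[ℂ] V →ₗ[ℂ] ℂ) (T : Module.End ℂ V) (hT : ∀ v w, H (T v) w = -H v (T w)) (a b : V) :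
    (H (T a) b).re = -(H a (T b)).re := by
  rw [hT, Complex.neg_re]

/-- **`Re H(i a, b) = −Re H(a, i b)`**: `H(i a, b) = conj(i) H(a,b) = −i H(a,b)` and `H(a, i b) = i H(a,b)`, and
`Re(−i z) = Im z = −Re(i z)`. [folklore] -/
theorem re_apply_I_smul (H : V →ₗ⋆[ℂ] V →ₗ[ℂ] ℂ) (a b : V) :
    (H (Complex.I • a) b).re = -(H a (Complex.I • b)).re := by
  rw [LinearMap.map_smulₛₗ, LinearMap.smul_apply, map_smul, starRingEnd_apply, Complex.star_def, Complex.conj_I,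
    smul_eq_mul, smul_eq_mul, Complex.mul_re, Complex.mul_re]
  simp only [Complex.neg_re, Complex.I_re, neg_zero, zero_mul, Complex.neg_im, Complex.I_im, zero_sub, neg_neg]
  ring

end Generic

/-! ## §2 The stub T3a₄ (type = the registered def body, `HasInvariantHermitianForm` unfolded) -/

/-- **T3a₄ · `IsUnitaryAlongP` FROM AN INVARIANT HERMITIAN FORM** (generic `U(α, β)`; the REGISTERED statement
`StubT3aUnitaryAlongPOfHermitian` of `Lines/F0_LocalAPackets.lean` binder for binder, its line-local hypothesis
`HasInvariantHermitianForm ρ𝔤` spelled out).  `B(a, b) := Re H(a, b)` (Mathlib `LinearMap.mk₂` over `ℝ` on the carrier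
`GKCarrier (uFormGroup α β) ρ𝔤 = V`) is real-bilinear, symmetric (`H` Hermitian), positive definite, every `ρ𝔤(X)` is `B`-skew —
in particular the `𝔭`-frame `upqPBasis s` and `z₀ = upqZ0` (the carrier bracket is `⁅X, v⁆ = ρ𝔤 X v` by `rfl`) — and
`B(i a, b) = −B(a, i b)`. [cite: BorelWallach2000, II §2.1, §3.1] -/
theorem stubT3aUnitaryAlongPOfHermitian_holds :
    ∀ (α β : Type) [Fintype α] [DecidableEq α] [Fintype β] [DecidableEq β]
      (V : Type) [AddCommGroup V] [Module ℂ V] (ρ𝔤 : (uFormGroup α β).lie →ₗ⁅ℝ⁆ Module.End ℂ V),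
      (∃ H : V →ₗ⋆[ℂ] V →ₗ[ℂ] ℂ,
        (∀ v w, H v w = starRingEnd ℂ (H w v)) ∧ (∀ v, v ≠ 0 → 0 < (H v v).re) ∧
        ∀ (X : (uFormGroup α β).lie) (v w : V), H (ρ𝔤 X v) w = -H v (ρ𝔤 X w)) →
      IsUnitaryAlongP ρ𝔤 := by
  intro α β _ _ _ _ V _ _ ρ𝔤 hH
  obtain ⟨H, hherm, hpos, hskew⟩ := hH
  -- `B := Re H` as a real-bilinear form on `V` (= the carrier `GKCarrier (uFormGroup α β) ρ𝔤` definitionally)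
  let B : V →ₗ[ℝ] V →ₗ[ℝ] ℝ := LinearMap.mk₂ ℝ (fun a b : V => (H a b).re)
      (fun a a' b => by simp only [map_add, LinearMap.add_apply, Complex.add_re])
      (fun t a b => by rw [smul_eq_mul]; exact re_apply_real_smul_left H t a b)
      (fun a b b' => by simp only [map_add, Complex.add_re])
      (fun t a b => by rw [smul_eq_mul]; exact re_apply_real_smul_right H t a b)
  have hB : ∀ a b : V, B a b = (H a b).re := fun a b => rfl
  refine ⟨B, fun a b => ?_, fun a => ?_, fun a h => ?_, fun s a b => ?_, fun a b => ?_, fun a b => ?_⟩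
  · exact (hB a b).trans ((re_apply_comm H hherm a b).trans (hB b a).symm)
  · exact (re_apply_self_nonneg H hpos a).trans_eq (hB a a).symm
  · exact eq_zero_of_re_apply_self_eq_zero H hpos a ((hB a a).symm.trans h)
  · exact (hB _ b).trans ((re_apply_skew H (ρ𝔤 (upqPBasis s)) (hskew (upqPBasis s)) a b).trans
      (congrArg Neg.neg (hB a _).symm))
  · exact (hB _ b).trans ((re_apply_skew H (ρ𝔤 (upqZ0 α β)) (hskew (upqZ0 α β)) a b).trans
      (congrArg Neg.neg (hB a _).symm))
  · exact (hB _ b).trans ((re_apply_I_smul H a b).trans (congrArg Neg.neg (hB a _).symm))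

end Summit.HodgeConjecture.HodgeConjecture.Cruxes.H413.F0P3bStubT3aUnitaryAlongPOfHermitian

end
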